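import Literature.AlgebraicGeometry.ShimuraVarieties.UnitaryAuxiliaryTorusClassNumber
import Literature.NumberTheory.NumberFields.PrincipalIdelesFiniteClosure
import Literature.NumberTheory.NumberFields.CyclotomicCharacterIdeleRange
import Literature.NumberTheory.Automorphic.IdeleIdealClass
import Literature.NumberTheory.Automorphic.UnramifiedLevelChange
import Literature.NumberTheory.GaloisRepresentations.UnitIdeles
import Mathlib.NumberTheory.NumberField.ClassNumber
import Mathlib.NumberTheory.NumberField.Units.DirichletTheorem
import HarnessLib

/-!
# The class number of the auxiliary torus `T₀` is finite — DISCHARGE of `Aux.finite_classGroup_printed` (glue g5)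

Topic `AlgebraicGeometry/ShimuraVarieties`; namespace `Literature.AlgebraicGeometry.ShimuraVarieties.UnitaryCanonicalModel.Aux`.
KERNEL ONLY: theorems (proved), no definition, no named fact, no `sorry`.  Discharges the named fact
`Aux.finite_classGroup_printed` of `UnitaryAuxiliaryTorusClassNumber.lean` ([BorelIHES1963, Thm. 5.1] read for the
`ℚ`-torus `T₀ = {z ∈ Res_{L/ℚ} 𝔾_m | z · z̄ ∈ 𝔾_{m,ℚ}}` of a CM field `L`): for every open compact
`L₀ ≤ T₀(𝔸_f)`, `T₀(𝔸_f) ⧸ (T₀(ℚ) · L₀)` is FINITE.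

**Proof (elementary: class group of `𝒪_L`, Dirichlet's unit theorem, `h_ℚ = 1`; no reduction theory).**  Write
`G = 𝔸_{L,f}^×`, `T = T₀(𝔸_f) ≤ G`, `R = T₀(ℚ) ≤ T`, `𝒰 ≤ G` the unit idèles (`ord_v = 0` everywhere; kernel of the
idèle-to-ideal map `IdeleIdeal.toIdealUnits`), `U_T = T ∩ 𝒰`, `c` complex conjugation.
* §1 `h_ℚ = 1` on idèles: every `q̃ ∈ 𝔸_{ℚ,f}^×` is `(q) · ũ` with `q ∈ ℚ^×`, `ũ` a unit idèle; unit idèles and principal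
  idèles behave under the continuous homomorphisms `c ⊗ 1` and base change `𝔸_{ℚ,f} → 𝔸_{L,f}`.
* §2 KERNEL LEMMA: if `t ∈ T` is `(k) · u` with `k ∈ L^×`, `u ∈ 𝒰`, then `k · k̄ = q · ε` with `q ∈ ℚ^×` and `ε` a
  `c`-FIXED unit of `𝒪_L` (the ideal of `k k̄` is extended from `ℚ`, hence principal).
* §3 the group `A` of `c`-fixed units is finitely generated (Dirichlet) so `A/A²` is finite.
* §4 CELLS: two elements of `K = {t ∈ T | ideal class of t trivial}` whose units `ε` (§2) agree modulo `A²` are congruent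
  modulo `R · U_T`; so `K/(R·U_T) ↪ A/A²` and `T/K ↪ Cl(𝒪_L)`: `T/(R·U_T)` is finite.
* §5 TOPOLOGY: `U_T` is compact (closed in the compact `𝒰`), so the open `L₀ ≤ U_T` has finite index in it; hence
  `T/(R·L₀)` is finite — `Aux.finite_classGroup_printed_holds`.

HC_CM is proved only modulo the 7 printed citations until rung 0 closes; this file removes the interface debt g5 only.

## References
* [BorelIHES1963] A. Borel, Publ. Math. IHÉS 16 (1963), §5 Thm. 5.1.
* [PlatonovRapinchuk1994] V. Platonov, A. Rapinchuk, *Algebraic Groups and Number Theory*, Thm. 5.1, §8.1.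
* [CasselsFrohlichANT1967] Ch. II §17–§19 (idèles and ideals, unit idèles).
-/

set_option autoImplicit false

noncomputable section

open NumberField IsDedekindDomain
open scoped RestrictedProduct

namespace Literature.AlgebraicGeometry.ShimuraVarieties.UnitaryCanonicalModel.Aux

open Literature.NumberTheory.Automorphic Literature.NumberTheory.Automorphic.UnitaryGroup
open Literature.NumberTheory.NumberFields Literature.NumberTheory.NumberFields.IdeleIdeal
open Literature.NumberTheory.GaloisRepresentations

/-! ## §1 Unit idèles, principal idèles, `h_ℚ = 1` -/

section Rational

/-- **`h_ℚ = 1` on finite idèles**: every `q̃ ∈ 𝔸_{ℚ,f}^×` is a principal idèle times a unit idèle, `q̃ = (q) · ũ`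
with `ord_p ũ = 0` for all `p` (the ideal of `q̃` is principal, `Cl(ℤ) = 1`). [cite: CasselsFrohlichANT1967, Ch. VII §5.7] -/
theorem exists_unitEmbedding_mul_of_rat (x : (FiniteAdeleRing (𝓞 ℚ) ℚ)ˣ) :
    ∃ (q : ℚˣ) (u : (FiniteAdeleRing (𝓞 ℚ) ℚ)ˣ), u ∈ (toIdealUnits (𝓞 ℚ) ℚ).ker ∧
      x = IsDedekindDomain.FiniteAdeleRing.unitEmbedding (𝓞 ℚ) ℚ q * u := by
  haveI : Subsingleton (ClassGroup (𝓞 ℚ)) := by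
    rw [← Fintype.card_le_one_iff_subsingleton]
    exact le_of_eq Rat.classNumber_eq
  obtain ⟨q, hq⟩ := Literature.NumberTheory.Automorphic.FiniteAdeleRing.exists_unitOrd_eq_zero_of_idealClass_eq (R := 𝓞 ℚ) (K := ℚ)
    (x := x) (t := 1) (Subsingleton.elim _ _)
  refine ⟨q, x * (IsDedekindDomain.FiniteAdeleRing.unitEmbedding (𝓞 ℚ) ℚ q)⁻¹, ?_, ?_⟩
  · rw [mem_ker_toIdealUnits_iff]
    simpa only [inv_one, mul_one] using hq
  · rw [mul_comm, inv_mul_cancel_right]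

end Rational

/-! ## §2 The kernel lemma: `k · k̄` is rational up to a `c`-fixed unit -/

section Kernel

variable (L : Type) [Field L] [NumberField L] [IsCMField L]

/-- `c ⊗ 1` on the finite idèles of the CM field `L` is continuous (as a map of units). [cite: CasselsFrohlichANT1967, Ch. VII §1.1] -/
theorem continuous_units_map_conjFiniteAdele :
    Continuous (Units.map (conjFiniteAdele (↥(maximalRealSubfield L)) L (IsCMField.complexConj L) :
      FiniteAdeleRing (𝓞 L) L →* FiniteAdeleRing (𝓞 L) L)) :=
  Continuous.units_map _ (continuous_conjFiniteAdele (↥(maximalRealSubfield L)) L (IsCMField.complexConj L))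

omit [IsCMField L] in
/-- base change `𝔸_{ℚ,f}^× → 𝔸_{L,f}^×` is continuous (as a map of units). [cite: CasselsFrohlichANT1967, Ch. II §14] -/
theorem continuous_units_map_baseChange :
    Continuous (Units.map (FiniteAdeleRing.baseChange (𝓞 ℚ) ℚ L (𝓞 L) : FiniteAdeleRing (𝓞 ℚ) ℚ →* FiniteAdeleRing (𝓞 L) L)) :=
  Continuous.units_map _ (FiniteAdeleRing.continuous_baseChange (𝓞 ℚ) ℚ L (𝓞 L))

/-- `(c ⊗ 1)` of a principal idèle: `(c ⊗ 1)(k) = (c k)`. [cite: CasselsFrohlichANT1967, Ch. VII §1.1] -/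
theorem conjFiniteAdele_unitEmbedding (k : Lˣ) :
    (Units.map (conjFiniteAdele (↥(maximalRealSubfield L)) L (IsCMField.complexConj L) :
        FiniteAdeleRing (𝓞 L) L →* FiniteAdeleRing (𝓞 L) L) (IsDedekindDomain.FiniteAdeleRing.unitEmbedding (𝓞 L) L k) :
        FiniteAdeleRing (𝓞 L) L) =
      algebraMap L (FiniteAdeleRing (𝓞 L) L) (IsCMField.complexConj L k) := by
  rw [Units.coe_map, IsDedekindDomain.FiniteAdeleRing.unitEmbedding_apply, MonoidHom.coe_coe, conjFiniteAdele_apply,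
    FiniteAdeleRing.smul_algebraMap, AlgEquiv.smul_def]

omit [IsCMField L] in
/-- base change of a principal idèle: `((q)_{𝔸_ℚ})_L = (q)_{𝔸_L}`. [cite: CasselsFrohlichANT1967, Ch. II §14] -/
theorem baseChange_unitEmbedding (q : ℚˣ) :
    Units.map (FiniteAdeleRing.baseChange (𝓞 ℚ) ℚ L (𝓞 L) : FiniteAdeleRing (𝓞 ℚ) ℚ →* FiniteAdeleRing (𝓞 L) L)
        (IsDedekindDomain.FiniteAdeleRing.unitEmbedding (𝓞 ℚ) ℚ q) =
      IsDedekindDomain.FiniteAdeleRing.unitEmbedding (𝓞 L) L (Units.map (algebraMap ℚ L : ℚ →* L) q) := by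
  ext
  rw [Units.coe_map, IsDedekindDomain.FiniteAdeleRing.unitEmbedding_apply, MonoidHom.coe_coe,
    FiniteAdeleRing.baseChange_algebraMap, IsDedekindDomain.FiniteAdeleRing.unitEmbedding_apply, Units.coe_map,
    MonoidHom.coe_coe]

/-- **KERNEL LEMMA.**  If `t ∈ T₀(𝔸_f)` decomposes as `t = (k) · u` with `k ∈ L^×` and `u` a unit idèle, then
`k · c(k) = q · ε` for some `q ∈ ℚ^×` and some `c`-FIXED UNIT `ε ∈ 𝒪_L^×`: the idèle of `k·c(k)` is `(q̃) · (u c(u))⁻¹` with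
`q̃ ∈ 𝔸_{ℚ,f}^×`, and `q̃ = (q) ũ` (`h_ℚ = 1`), so `(k c(k) / q)` is a principal UNIT idèle, i.e. a global unit.
[cite: CasselsFrohlichANT1967, Ch. II §17–§19] -/
theorem exists_rat_mul_unit_of_mem_torusFinAdelic {t u : (FiniteAdeleRing (𝓞 L) L)ˣ} {k : Lˣ}
    (ht : t ∈ torusFinAdelic L) (hu : u ∈ (toIdealUnits (𝓞 L) L).ker)
    (htk : t = IsDedekindDomain.FiniteAdeleRing.unitEmbedding (𝓞 L) L k * u) :
    ∃ (q : ℚˣ) (v : (𝓞 ↥(maximalRealSubfield L))ˣ),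
      (k : L) * IsCMField.complexConj L k =
        algebraMap ℚ L q * algebraMap (𝓞 ↥(maximalRealSubfield L)) L (v : 𝓞 ↥(maximalRealSubfield L)) := by
  -- notation
  set σG : (FiniteAdeleRing (𝓞 L) L)ˣ →* (FiniteAdeleRing (𝓞 L) L)ˣ :=
    Units.map (conjFiniteAdele (↥(maximalRealSubfield L)) L (IsCMField.complexConj L) :
      FiniteAdeleRing (𝓞 L) L →* FiniteAdeleRing (𝓞 L) L) with hσG
  set bcG : (FiniteAdeleRing (𝓞 ℚ) ℚ)ˣ →* (FiniteAdeleRing (𝓞 L) L)ˣ :=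
    Units.map (FiniteAdeleRing.baseChange (𝓞 ℚ) ℚ L (𝓞 L) : FiniteAdeleRing (𝓞 ℚ) ℚ →* FiniteAdeleRing (𝓞 L) L) with hbcG
  have hck0 : IsCMField.complexConj L (k : L) ≠ 0 := by
    rw [map_ne_zero_iff _ (IsCMField.complexConj L).injective]
    exact k.ne_zero
  set kc : Lˣ := Units.mk0 _ hck0 with hkc
  -- the torus relation on units: `t · σ t = bc q̃`
  obtain ⟨q', hq'⟩ := ht
  have hT : t * σG t = bcG q' := Units.ext (by simpa [hσG, hbcG] using hq')
  -- `σ (k) = (c k)`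
  have hσk : σG (IsDedekindDomain.FiniteAdeleRing.unitEmbedding (𝓞 L) L k) =
      IsDedekindDomain.FiniteAdeleRing.unitEmbedding (𝓞 L) L kc :=
    Units.ext (by rw [hσG, conjFiniteAdele_unitEmbedding]; rfl)
  -- `h_ℚ = 1`: `q̃ = (q) ũ`
  obtain ⟨q, uq, huq, hq⟩ := exists_unitEmbedding_mul_of_rat q'
  -- the idèle `(k kc q⁻¹) = bc ũ · (u σ u)⁻¹` is a unit idèle
  set qL : Lˣ := Units.map (algebraMap ℚ L : ℚ →* L) q with hqL
  have hkey : IsDedekindDomain.FiniteAdeleRing.unitEmbedding (𝓞 L) L (k * kc * qL⁻¹) = bcG uq * (u * σG u)⁻¹ := by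
    have h1 : t * σG t = IsDedekindDomain.FiniteAdeleRing.unitEmbedding (𝓞 L) L (k * kc) * (u * σG u) := by
      rw [htk, map_mul, hσk, map_mul]
      simp only [mul_assoc, mul_left_comm]
    have h2 : bcG q' = IsDedekindDomain.FiniteAdeleRing.unitEmbedding (𝓞 L) L qL * bcG uq := by
      rw [hq, map_mul, hbcG, baseChange_unitEmbedding]
    have h3 : IsDedekindDomain.FiniteAdeleRing.unitEmbedding (𝓞 L) L (k * kc) * (u * σG u) =
        IsDedekindDomain.FiniteAdeleRing.unitEmbedding (𝓞 L) L qL * bcG uq := by rw [← h1, hT, h2]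
    rw [map_mul, map_inv, ← div_eq_mul_inv, ← div_eq_mul_inv, div_eq_div_iff_mul_eq_mul, h3, mul_comm]
  have hunit : IsDedekindDomain.FiniteAdeleRing.unitEmbedding (𝓞 L) L (k * kc * qL⁻¹) ∈ (toIdealUnits (𝓞 L) L).ker := by
    rw [hkey]
    refine Subgroup.mul_mem _ ?_ (Subgroup.inv_mem _ (Subgroup.mul_mem _ hu ?_))
    · exact map_ker_le_ker bcG (by rw [hbcG]; exact continuous_units_map_baseChange L) (Subgroup.mem_map_of_mem bcG huq)
    · exact map_ker_le_ker σG (by rw [hσG]; exact continuous_units_map_conjFiniteAdele L) (Subgroup.mem_map_of_mem σG hu)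
  obtain ⟨ε, hε⟩ := (FiniteIdeleClosure.unitEmbedding_mem_ker_iff L _).1 hunit
  have hεval : ((ε : 𝓞 L) : L) = (k : L) * IsCMField.complexConj L k * (algebraMap ℚ L q)⁻¹ := by
    have h := congrArg Units.val hε
    simp only [Units.coe_map, MonoidHom.coe_coe, Units.val_mul, Units.val_inv_eq_inv_val, hkc, Units.val_mk0, hqL] at h
    exact h
  have hq0 : (algebraMap ℚ L q : L) ≠ 0 := by
    rw [map_ne_zero_iff _ (algebraMap ℚ L).injective]
    exact q.ne_zero
  have hεc : IsCMField.complexConj L ((ε : 𝓞 L) : L) = ((ε : 𝓞 L) : L) := by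
    rw [hεval, eq_ratCast, map_mul, map_mul, map_inv₀, IsCMField.complexConj_apply_apply, map_ratCast,
      mul_comm (IsCMField.complexConj L (k : L)) (k : L)]
  obtain ⟨v, hv⟩ := (IsCMField.Units.complexConj_eq_self_iff L ε).1 hεc
  refine ⟨q, v, ?_⟩
  have hεval' : algebraMap (𝓞 L) L (ε : 𝓞 L) = (k : L) * IsCMField.complexConj L k * (algebraMap ℚ L q)⁻¹ := hεval
  rw [hv, hεval', mul_comm ((algebraMap ℚ L) q), inv_mul_cancel_right₀ hq0]

end Kernel

/-! ## §3 Dirichlet: real units modulo squares are finite -/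

section Units

/-- **`𝒪_K^× / (𝒪_K^×)²` is finite** for a number field `K` (Dirichlet: `𝒪_K^×` is finitely generated, Mathlib
`Module.Finite ℤ (Additive (𝓞 K)ˣ)`; a finitely generated abelian group of exponent `2` is finite).
[cite: CasselsFrohlichANT1967, Ch. II §18 (unit theorem)] -/
theorem finite_units_quotient_range_sq (K : Type) [Field K] [NumberField K] :
    Finite ((𝓞 K)ˣ ⧸ (powMonoidHom 2 : (𝓞 K)ˣ →* (𝓞 K)ˣ).range) := by
  haveI : AddGroup.FG (Additive (𝓞 K)ˣ) := Module.Finite.iff_addGroup_fg.mp inferInstance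
  haveI : Group.FG (𝓞 K)ˣ := Group.fg_of_mul_group_fg (H := Additive (𝓞 K)ˣ)
  refine CommGroup.finite_of_fg_torsion _ fun g => ?_
  obtain ⟨x, rfl⟩ := QuotientGroup.mk_surjective g
  refine isOfFinOrder_iff_pow_eq_one.2 ⟨2, two_pos, ?_⟩
  rw [← QuotientGroup.mk_pow, QuotientGroup.eq_one_iff]
  exact ⟨x, rfl⟩

end Units

/-! ## §4 Cells: `T ⧸ (T₀(ℚ) · (T ∩ 𝒰))` is finite -/

section Cells

variable (L : Type) [Field L] [NumberField L] [IsCMField L]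

/-- the diagonal image of `κ ∈ T₀(ℚ)` lies in `T₀(𝔸_f)` (value of `toTorusFinAdelic`). [cite: Milne2005ShimuraVarieties, p. 62 L34–40] -/
private theorem unitEmbedding_mem_torusFinAdelic {κ : Lˣ} (hκ : κ ∈ torusRat L) :
    IsDedekindDomain.FiniteAdeleRing.unitEmbedding (𝓞 L) L κ ∈ torusFinAdelic L :=
  (toTorusFinAdelic L ⟨κ, hκ⟩).2

/-- **CELLS.**  Two elements `t, t′ ∈ T₀(𝔸_f)` decomposed as `(k)·u`, `(k′)·u′` (`u, u′` unit idèles) whose real units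
(`k k̄ = q v`, `k′ k̄′ = q′ v′`, §2) differ by a SQUARE, `v′ = v b²`, are congruent modulo `T₀(ℚ) · (T ∩ 𝒰)`:
`t⁻¹ t′ = (κ) · w` with `κ = k′ k⁻¹ b⁻¹ ∈ T₀(ℚ)` (`κ κ̄ = q′/q`) and `w = (b) u⁻¹ u′` a unit idèle in `T`.
[cite: CasselsFrohlichANT1967, Ch. II §17–§19] -/
theorem inv_mul_mem_sup_of_sq {t t' : ↥(torusFinAdelic L)} {k k' : Lˣ} {u u' : (FiniteAdeleRing (𝓞 L) L)ˣ}
    (hu : u ∈ (toIdealUnits (𝓞 L) L).ker) (hu' : u' ∈ (toIdealUnits (𝓞 L) L).ker)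
    (ht : (t : (FiniteAdeleRing (𝓞 L) L)ˣ) = IsDedekindDomain.FiniteAdeleRing.unitEmbedding (𝓞 L) L k * u)
    (ht' : (t' : (FiniteAdeleRing (𝓞 L) L)ˣ) = IsDedekindDomain.FiniteAdeleRing.unitEmbedding (𝓞 L) L k' * u')
    {q q' : ℚˣ} {v v' b : (𝓞 ↥(maximalRealSubfield L))ˣ}
    (hk : (k : L) * IsCMField.complexConj L k =
      algebraMap ℚ L q * algebraMap (𝓞 ↥(maximalRealSubfield L)) L (v : 𝓞 ↥(maximalRealSubfield L)))
    (hk' : (k' : L) * IsCMField.complexConj L k' =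
      algebraMap ℚ L q' * algebraMap (𝓞 ↥(maximalRealSubfield L)) L (v' : 𝓞 ↥(maximalRealSubfield L)))
    (hb : v' = v * b ^ 2) :
    t⁻¹ * t' ∈ (toTorusFinAdelic L).range ⊔ ((toIdealUnits (𝓞 L) L).ker.comap (torusFinAdelic L).subtype) := by
  -- the real unit `b` as a unit of `L` and of `𝓞 L`
  set bO : (𝓞 L)ˣ := Units.map (algebraMap (𝓞 ↥(maximalRealSubfield L)) (𝓞 L) : 𝓞 ↥(maximalRealSubfield L) →* 𝓞 L) b
    with hbO
  set bL : Lˣ := Units.map (algebraMap (𝓞 L) L : 𝓞 L →* L) bO with hbL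
  have hbLval : (bL : L) = algebraMap (𝓞 ↥(maximalRealSubfield L)) L (b : 𝓞 ↥(maximalRealSubfield L)) := by
    rw [hbL, hbO, Units.coe_map, Units.coe_map, MonoidHom.coe_coe, MonoidHom.coe_coe,
      ← IsScalarTower.algebraMap_apply]
  have hbc : IsCMField.complexConj L (bL : L) = bL := by
    rw [hbLval, IsScalarTower.algebraMap_apply (𝓞 ↥(maximalRealSubfield L)) ↥(maximalRealSubfield L) L]
    exact IsCMField.complexConj_apply_eq_self L _
  have hb0 : (bL : L) ≠ 0 := bL.ne_zero
  have hq0 : (algebraMap ℚ L q : L) ≠ 0 := by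
    rw [map_ne_zero_iff _ (algebraMap ℚ L).injective]; exact q.ne_zero
  have hvv' : algebraMap (𝓞 ↥(maximalRealSubfield L)) L (v' : 𝓞 ↥(maximalRealSubfield L)) =
      algebraMap (𝓞 ↥(maximalRealSubfield L)) L (v : 𝓞 ↥(maximalRealSubfield L)) * (bL : L) ^ 2 := by
    rw [hb, Units.val_mul, Units.val_pow_eq_pow_val, map_mul, map_pow, hbLval]
  -- `κ = k' k⁻¹ b⁻¹ ∈ T₀(ℚ)`
  set κ : Lˣ := k' * k⁻¹ * bL⁻¹ with hκdef
  have hκ : κ ∈ torusRat L := by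
    refine ⟨q' * q⁻¹, ?_⟩
    have hkc0 : IsCMField.complexConj L (k : L) ≠ 0 := by
      rw [map_ne_zero_iff _ (IsCMField.complexConj L).injective]; exact k.ne_zero
    have hv0 : algebraMap (𝓞 ↥(maximalRealSubfield L)) L (v : 𝓞 ↥(maximalRealSubfield L)) ≠ 0 := by
      intro h0
      rw [h0, mul_zero] at hk
      exact mul_ne_zero k.ne_zero hkc0 hk
    rw [hκdef, Units.val_mul, Units.val_mul, Units.val_inv_eq_inv_val, Units.val_inv_eq_inv_val, map_mul, map_mul,
      map_inv₀, map_inv₀, hbc, Units.val_mul, Units.val_inv_eq_inv_val, map_mul, map_inv₀]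
    have e1 : (k' : L) * (k : L)⁻¹ * (bL : L)⁻¹ *
        (IsCMField.complexConj L k' * (IsCMField.complexConj L k)⁻¹ * (bL : L)⁻¹) =
        ((k' : L) * IsCMField.complexConj L k') * ((k : L) * IsCMField.complexConj L k)⁻¹ * ((bL : L) ^ 2)⁻¹ := by
      field_simp
    rw [e1, hk, hk', hvv']
    field_simp
  -- `w = (b) · u⁻¹ u'` is a unit idèle lying in `T`
  have hbU : IsDedekindDomain.FiniteAdeleRing.unitEmbedding (𝓞 L) L bL ∈ (toIdealUnits (𝓞 L) L).ker :=
    FiniteIdeleClosure.unitEmbedding_unit_mem_ker L bO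
  set w : (FiniteAdeleRing (𝓞 L) L)ˣ := IsDedekindDomain.FiniteAdeleRing.unitEmbedding (𝓞 L) L bL * (u⁻¹ * u') with hw
  have hwU : w ∈ (toIdealUnits (𝓞 L) L).ker :=
    Subgroup.mul_mem _ hbU (Subgroup.mul_mem _ (Subgroup.inv_mem _ hu) hu')
  have hprod : ((t⁻¹ * t' : ↥(torusFinAdelic L)) : (FiniteAdeleRing (𝓞 L) L)ˣ) =
      IsDedekindDomain.FiniteAdeleRing.unitEmbedding (𝓞 L) L κ * w := by
    rw [Subgroup.coe_mul, Subgroup.coe_inv, ht, ht', hw, hκdef, map_mul, map_mul, map_inv, map_inv]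
    apply Additive.ofMul.injective
    simp only [ofMul_mul, ofMul_inv, mul_inv_rev]
    abel
  have hwT : w ∈ torusFinAdelic L := by
    have h : w = (IsDedekindDomain.FiniteAdeleRing.unitEmbedding (𝓞 L) L κ)⁻¹ *
        ((t⁻¹ * t' : ↥(torusFinAdelic L)) : (FiniteAdeleRing (𝓞 L) L)ˣ) := by
      rw [hprod, inv_mul_cancel_left]
    rw [h]
    exact Subgroup.mul_mem _ (Subgroup.inv_mem _ (unitEmbedding_mem_torusFinAdelic L hκ)) (t⁻¹ * t').2
  -- assemble in `↥T`
  have heq : t⁻¹ * t' = toTorusFinAdelic L ⟨κ, hκ⟩ * ⟨w, hwT⟩ := Subtype.ext hprod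
  rw [heq]
  exact Subgroup.mul_mem_sup ⟨⟨κ, hκ⟩, rfl⟩ (by rw [Subgroup.mem_comap]; exact hwU)

end Cells

/-! ## §5 Topology: `T ∩ 𝒰` is compact; an open level has finite index in it -/

section Topology

variable (L : Type) [Field L] [NumberField L] [IsCMField L]

omit [IsCMField L] in
/-- a rational number whose image in `L` is a UNIT of `𝒪_L` is `±1` (it and its inverse are algebraic integers, hence
integers). [folklore] -/
private theorem rat_units_eq_one_or_neg_one {q : ℚˣ} {ε : (𝓞 L)ˣ}
    (h : algebraMap (𝓞 L) L (ε : 𝓞 L) = algebraMap ℚ L q) : q = 1 ∨ q = -1 := by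
  have hint : ∀ (r : ℚ) (e : 𝓞 L), algebraMap (𝓞 L) L e = algebraMap ℚ L r → ∃ n : ℤ, (n : ℚ) = r := by
    intro r e he
    have hi : IsIntegral ℤ (algebraMap ℚ L r) := by rw [← he]; exact RingOfIntegers.isIntegral_coe e
    rw [isIntegral_algebraMap_iff (algebraMap ℚ L).injective] at hi
    obtain ⟨n, hn⟩ := IsIntegrallyClosed.isIntegral_iff.mp hi
    exact ⟨n, by simpa using hn⟩
  obtain ⟨n, hn⟩ := hint _ _ h
  have h' : algebraMap (𝓞 L) L ((ε⁻¹ : (𝓞 L)ˣ) : 𝓞 L) = algebraMap ℚ L ((q⁻¹ : ℚˣ) : ℚ) := by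
    rw [Units.val_inv_eq_inv_val q, map_inv₀, ← h]
    exact eq_inv_of_mul_eq_one_left (by rw [← map_mul, Units.inv_mul, map_one])
  obtain ⟨m, hm⟩ := hint _ _ h'
  have hnm : n * m = 1 := by
    have : (n : ℚ) * m = 1 := by rw [hn, hm, Units.val_inv_eq_inv_val, mul_inv_cancel₀ q.ne_zero]
    exact_mod_cast this
  rcases Int.eq_one_or_neg_one_of_mul_eq_one hnm with h1 | h1
  · left
    apply Units.ext
    rw [Units.val_one, ← hn, h1, Int.cast_one]
  · right
    apply Units.ext
    rw [Units.val_neg, Units.val_one, ← hn, h1, Int.cast_neg, Int.cast_one]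

/-- **`T₀(𝔸_f) ∩ 𝒰` is compact**: inside the compact group `𝒰` of unit idèles it is the closed set
`{z ∈ 𝒰 | z · (c⊗1) z ∈ bc(𝒰_ℚ)}` (for `z ∈ 𝒰`, if `z (c⊗1) z = bc q̃` with `q̃ = (q) ũ` then `(q)_{𝔸_L}` is a unit
idèle, so `q = ±1` and `q̃` is itself a unit idèle; `bc(𝒰_ℚ)` is compact, hence closed).
[cite: CasselsFrohlichANT1967, Ch. II §17–§19] -/
theorem isCompact_torusFinAdelic_inter_ker :
    IsCompact ((torusFinAdelic L : Set (FiniteAdeleRing (𝓞 L) L)ˣ) ∩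
      ((toIdealUnits (𝓞 L) L).ker : Set (FiniteAdeleRing (𝓞 L) L)ˣ)) := by
  haveI : T2Space (FiniteAdeleRing (𝓞 L) L) := inferInstanceAs <| T2Space
    (Πʳ w : HeightOneSpectrum (𝓞 L), [w.adicCompletion L, w.adicCompletionIntegers L])
  set σG : (FiniteAdeleRing (𝓞 L) L)ˣ →* (FiniteAdeleRing (𝓞 L) L)ˣ :=
    Units.map (conjFiniteAdele (↥(maximalRealSubfield L)) L (IsCMField.complexConj L) :
      FiniteAdeleRing (𝓞 L) L →* FiniteAdeleRing (𝓞 L) L) with hσG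
  set bcG : (FiniteAdeleRing (𝓞 ℚ) ℚ)ˣ →* (FiniteAdeleRing (𝓞 L) L)ˣ :=
    Units.map (FiniteAdeleRing.baseChange (𝓞 ℚ) ℚ L (𝓞 L) : FiniteAdeleRing (𝓞 ℚ) ℚ →* FiniteAdeleRing (𝓞 L) L) with hbcG
  have hσc : Continuous σG := by rw [hσG]; exact continuous_units_map_conjFiniteAdele L
  have hbcc : Continuous bcG := by rw [hbcG]; exact continuous_units_map_baseChange L
  set B : Set (FiniteAdeleRing (𝓞 L) L)ˣ := bcG '' ((toIdealUnits (𝓞 ℚ) ℚ).ker : Set (FiniteAdeleRing (𝓞 ℚ) ℚ)ˣ) with hB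
  have hBc : IsClosed B := (isCompact_ker_toIdealUnits.image hbcc).isClosed
  have hμ : Continuous fun z : (FiniteAdeleRing (𝓞 L) L)ˣ => z * σG z := continuous_id.mul hσc
  -- the set identity
  have hset : (torusFinAdelic L : Set (FiniteAdeleRing (𝓞 L) L)ˣ) ∩ ((toIdealUnits (𝓞 L) L).ker : Set _) =
      ((toIdealUnits (𝓞 L) L).ker : Set _) ∩ (fun z => z * σG z) ⁻¹' B := by
    ext z
    simp only [Set.mem_inter_iff, SetLike.mem_coe, Set.mem_preimage, hB, Set.mem_image]
    constructor
    · rintro ⟨⟨q', hq'⟩, hz⟩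
      refine ⟨hz, ?_⟩
      have hzq : z * σG z = bcG q' := Units.ext (by simpa [hσG, hbcG] using hq')
      obtain ⟨q, uq, huq, hq⟩ := exists_unitEmbedding_mul_of_rat q'
      -- `(q)_{𝔸_L}` is a unit idèle
      have hqU : IsDedekindDomain.FiniteAdeleRing.unitEmbedding (𝓞 L) L (Units.map (algebraMap ℚ L : ℚ →* L) q) ∈
          (toIdealUnits (𝓞 L) L).ker := by
        have h1 : bcG q' ∈ (toIdealUnits (𝓞 L) L).ker := by
          rw [← hzq]
          exact Subgroup.mul_mem _ hz (map_ker_le_ker σG hσc (Subgroup.mem_map_of_mem σG hz))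
        have h2 : bcG uq ∈ (toIdealUnits (𝓞 L) L).ker := map_ker_le_ker bcG hbcc (Subgroup.mem_map_of_mem bcG huq)
        have h3 : bcG q' = IsDedekindDomain.FiniteAdeleRing.unitEmbedding (𝓞 L) L (Units.map (algebraMap ℚ L : ℚ →* L) q) *
            bcG uq := by rw [hq, map_mul, hbcG, baseChange_unitEmbedding]
        rw [h3] at h1
        simpa using Subgroup.mul_mem _ h1 (Subgroup.inv_mem _ h2)
      obtain ⟨ε, hε⟩ := (FiniteIdeleClosure.unitEmbedding_mem_ker_iff L _).1 hqU
      have hεq : algebraMap (𝓞 L) L (ε : 𝓞 L) = algebraMap ℚ L q := by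
        have h := congrArg Units.val hε
        simpa only [Units.coe_map, MonoidHom.coe_coe] using h
      have hq1 : IsDedekindDomain.FiniteAdeleRing.unitEmbedding (𝓞 ℚ) ℚ q ∈ (toIdealUnits (𝓞 ℚ) ℚ).ker :=
        (unitEmbedding_rat_mem_ker_toIdealUnits_iff q).2 (rat_units_eq_one_or_neg_one L hεq)
      exact ⟨q', by rw [hq]; exact Subgroup.mul_mem _ hq1 huq, hzq.symm⟩
    · rintro ⟨hz, q', hq', hzq⟩
      refine ⟨⟨q', ?_⟩, hz⟩
      have h := congrArg (fun u : (FiniteAdeleRing (𝓞 L) L)ˣ => (u : FiniteAdeleRing (𝓞 L) L)) hzq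
      simpa [hσG, hbcG] using h.symm
  rw [hset]
  exact isCompact_ker_toIdealUnits.inter_right (hBc.preimage hμ)

/-- … hence the «unit level» `U_T = T ∩ 𝒰`, as a subgroup of the topological group `T₀(𝔸_f)`, is compact.
[cite: CasselsFrohlichANT1967, Ch. II §17–§19] -/
theorem isCompact_comap_ker :
    IsCompact (((toIdealUnits (𝓞 L) L).ker.comap (torusFinAdelic L).subtype : Subgroup ↥(torusFinAdelic L)) :
      Set ↥(torusFinAdelic L)) := by
  rw [Topology.IsInducing.subtypeVal.isCompact_iff]
  convert isCompact_torusFinAdelic_inter_ker L using 1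
  ext z
  simp only [Set.mem_image, SetLike.mem_coe, Subgroup.mem_comap, Set.mem_inter_iff]
  constructor
  · rintro ⟨t, ht, rfl⟩
    exact ⟨t.2, ht⟩
  · rintro ⟨hzT, hzU⟩
    exact ⟨⟨z, hzT⟩, hzU, rfl⟩

/-- **Every open compact level `L₀ ≤ T₀(𝔸_f)` consists of unit idèles** (compact subgroups of the finite idèles have
`ord_v = 0`). [cite: CasselsFrohlichANT1967, Ch. II §17, §19] -/
theorem le_comap_ker_of_openCompact (L₀ : Literature.NumberTheory.Automorphic.Liu2021.AppendixC.C5.OpenCompactSubgroup ↥(torusFinAdelic L)) :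
    L₀.1 ≤ (toIdealUnits (𝓞 L) L).ker.comap (torusFinAdelic L).subtype := by
  intro x hx
  rw [Subgroup.mem_comap]
  have hC : IsCompact ((L₀.1.map (torusFinAdelic L).subtype : Subgroup (FiniteAdeleRing (𝓞 L) L)ˣ) :
      Set (FiniteAdeleRing (𝓞 L) L)ˣ) := by
    rw [Subgroup.coe_map]
    exact L₀.2.2.image continuous_subtype_val
  exact le_ker_toIdealUnits_of_isCompact hC ⟨x, hx, rfl⟩

end Topology

/-! ## §6 The class number of `T₀` is finite -/

section Main

variable (L : Type) [Field L] [NumberField L] [IsCMField L]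

/-- **`T₀(𝔸_f) ⧸ (T₀(ℚ) · U_T)` is finite**, `U_T = T₀(𝔸_f) ∩ 𝒰` the unit level: `T/K ↪ Cl(𝒪_L)` for
`K = {t | (t) principal}` and `K/(T₀(ℚ)·U_T) ↪ 𝒪_{L⁺}^× / (𝒪_{L⁺}^×)²` by §2–§4. [cite: CasselsFrohlichANT1967, Ch. II §17–§19] -/
theorem finiteIndex_range_sup_comap_ker :
    ((toTorusFinAdelic L).range ⊔ ((toIdealUnits (𝓞 L) L).ker.comap (torusFinAdelic L).subtype)).FiniteIndex := by
  classical
  -- the ideal-class homomorphism on `T`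
  let cl : ↥(torusFinAdelic L) →* ClassGroup (𝓞 L) :=
    MonoidHom.mk' (fun t => Literature.NumberTheory.Automorphic.FiniteAdeleRing.idealClass (𝓞 L) L (t : (FiniteAdeleRing (𝓞 L) L)ˣ))
      (fun a b => by
        rw [Subgroup.coe_mul]
        exact Literature.NumberTheory.GaloisRepresentations.FiniteAdeleRing.idealClass_mul _ _)
  have hcl : ∀ t : ↥(torusFinAdelic L), cl t = ClassGroup.mk L (toIdealUnits (𝓞 L) L (t : (FiniteAdeleRing (𝓞 L) L)ˣ)) :=
    fun t => rfl
  set N₁ := (toTorusFinAdelic L).range ⊔ ((toIdealUnits (𝓞 L) L).ker.comap (torusFinAdelic L).subtype) with hN₁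
  -- `N₁ ≤ ker cl`
  have hRK : (toTorusFinAdelic L).range ≤ cl.ker := by
    rintro _ ⟨z, rfl⟩
    rw [MonoidHom.mem_ker, hcl, ClassGroup.mk_eq_one_iff, coe_toTorusFinAdelic, coe_toIdealUnits_unitEmbedding]
    exact ⟨⟨(z.1 : L), FractionalIdeal.coe_spanSingleton _ _⟩⟩
  have hUK : (toIdealUnits (𝓞 L) L).ker.comap (torusFinAdelic L).subtype ≤ cl.ker := by
    intro t ht
    rw [Subgroup.mem_comap, MonoidHom.mem_ker, Subgroup.coe_subtype] at ht
    rw [MonoidHom.mem_ker, hcl, ht, map_one]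
  have hN₁K : N₁ ≤ cl.ker := sup_le hRK hUK
  -- (a) `T ⧸ ker cl` is finite
  haveI hKfin : cl.ker.FiniteIndex := by
    haveI : Finite (↥(torusFinAdelic L) ⧸ cl.ker) :=
      Finite.of_injective (QuotientGroup.kerLift cl) (QuotientGroup.kerLift_injective cl)
    exact Subgroup.finiteIndex_of_finite_quotient
  -- (b) `ker cl ⧸ N₁` injects into `𝒪_{L⁺}^× / squares`
  haveI : Finite ((𝓞 ↥(maximalRealSubfield L))ˣ ⧸ (powMonoidHom 2 : _ →* (𝓞 ↥(maximalRealSubfield L))ˣ).range) :=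
    finite_units_quotient_range_sq ↥(maximalRealSubfield L)
  -- choice of decompositions for `t ∈ ker cl`
  have hdec : ∀ t : cl.ker, ∃ (k : Lˣ) (u : (FiniteAdeleRing (𝓞 L) L)ˣ), u ∈ (toIdealUnits (𝓞 L) L).ker ∧
      ((t : ↥(torusFinAdelic L)) : (FiniteAdeleRing (𝓞 L) L)ˣ) = IsDedekindDomain.FiniteAdeleRing.unitEmbedding (𝓞 L) L k * u := by
    intro t
    have ht : Literature.NumberTheory.Automorphic.FiniteAdeleRing.idealClass (𝓞 L) L (1 : (FiniteAdeleRing (𝓞 L) L)ˣ) =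
        Literature.NumberTheory.Automorphic.FiniteAdeleRing.idealClass (𝓞 L) L
          ((t : ↥(torusFinAdelic L)) : (FiniteAdeleRing (𝓞 L) L)ˣ) := by
      rw [Literature.NumberTheory.GaloisRepresentations.FiniteAdeleRing.idealClass_one]
      exact ((MonoidHom.mem_ker).1 t.2).symm
    obtain ⟨k, hk⟩ := Literature.NumberTheory.Automorphic.FiniteAdeleRing.exists_unitOrd_eq_zero_of_idealClass_eq
      (R := 𝓞 L) (K := L) ht
    refine ⟨k, ((t : ↥(torusFinAdelic L)) : (FiniteAdeleRing (𝓞 L) L)ˣ) *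
      (IsDedekindDomain.FiniteAdeleRing.unitEmbedding (𝓞 L) L k)⁻¹, ?_, ?_⟩
    · rw [mem_ker_toIdealUnits_iff]
      simpa only [inv_one, mul_one] using hk
    · rw [mul_comm, inv_mul_cancel_right]
  choose kf uf huf htf using hdec
  have hku : ∀ t : cl.ker, ∃ (q : ℚˣ) (v : (𝓞 ↥(maximalRealSubfield L))ˣ),
      (kf t : L) * IsCMField.complexConj L (kf t) =
        algebraMap ℚ L q * algebraMap (𝓞 ↥(maximalRealSubfield L)) L (v : 𝓞 ↥(maximalRealSubfield L)) :=
    fun t => exists_rat_mul_unit_of_mem_torusFinAdelic L (t : ↥(torusFinAdelic L)).2 (huf t) (htf t)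
  choose qf vf hvf using hku
  -- the invariant in `𝒪_{L⁺}^× / squares` detects the class modulo `N₁`
  let inv : cl.ker ⧸ N₁.subgroupOf cl.ker → (𝓞 ↥(maximalRealSubfield L))ˣ ⧸ (powMonoidHom 2 : _ →* _).range :=
    fun c => QuotientGroup.mk (vf c.out)
  have hinj : Function.Injective inv := by
    intro c c' h
    have hvv : (vf c.out)⁻¹ * vf c'.out ∈ (powMonoidHom 2 : _ →* (𝓞 ↥(maximalRealSubfield L))ˣ).range :=
      QuotientGroup.eq.1 h
    obtain ⟨b, hb⟩ := hvv
    have hb' : vf c'.out = vf c.out * b ^ 2 := by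
      rw [powMonoidHom_apply] at hb
      rw [hb, mul_inv_cancel_left]
    have hmem := inv_mul_mem_sup_of_sq L (huf c.out) (huf c'.out) (htf c.out) (htf c'.out) (hvf c.out) (hvf c'.out) hb'
    rw [← QuotientGroup.out_eq' c, ← QuotientGroup.out_eq' c', QuotientGroup.eq, Subgroup.mem_subgroupOf, Subgroup.coe_mul,
      Subgroup.coe_inv]
    exact hmem
  haveI : Finite (cl.ker ⧸ N₁.subgroupOf cl.ker) := Finite.of_injective inv hinj
  haveI hrel : (N₁.subgroupOf cl.ker).FiniteIndex := Subgroup.finiteIndex_of_finite_quotient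
  -- (c) assemble
  constructor
  rw [← Subgroup.relIndex_mul_index hN₁K]
  exact mul_ne_zero hrel.1 hKfin.1

/-- **The class number of the auxiliary torus `T₀` is finite — DISCHARGE of the named fact
`Aux.finite_classGroup_printed`** ([BorelIHES1963, Thm. 5.1] for this torus): for every CM number field `L` and every open
compact `L₀ ≤ T₀(𝔸_f)`, `T₀(𝔸_f) ⧸ (T₀(ℚ) · L₀)` is finite.  By §6 (`finiteIndex_range_sup_comap_ker`) and §5: `L₀` lies in
the compact unit level `U_T` with finite index, so `T₀(ℚ)·L₀` has finite index in `T₀(ℚ)·U_T`, which has finite index in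
`T₀(𝔸_f)`. [cite: BorelIHES1963, §5 Thm. 5.1 (p. 19)] -/
theorem finite_classGroup_printed_holds : finite_classGroup_printed := by
  intro L _ _ _ L₀
  classical
  set R := (toTorusFinAdelic L).range with hR
  set U := (toIdealUnits (𝓞 L) L).ker.comap (torusFinAdelic L).subtype with hU
  set N := R ⊔ L₀.1 with hN
  set N₁ := R ⊔ U with hN₁
  have hLU : L₀.1 ≤ U := le_comap_ker_of_openCompact L L₀
  have hNN₁ : N ≤ N₁ := sup_le_sup_left hLU _
  haveI h₁ : N₁.FiniteIndex := finiteIndex_range_sup_comap_ker L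
  -- `[U : L₀] < ∞` (open subgroup of a compact group) gives `[N₁ : N] < ∞`
  haveI hLU' : (L₀.1.subgroupOf U).FiniteIndex :=
    Subgroup.finiteIndex_subgroupOf_of_isCompact_isOpen (isCompact_comap_ker L) L₀.2.1
  haveI : Finite (↥U ⧸ L₀.1.subgroupOf U) := Subgroup.finite_quotient_of_finiteIndex
  -- the surjection `U ⧸ L₀ ↠ N₁ ⧸ N`
  let φ : ↥U ⧸ L₀.1.subgroupOf U → ↥N₁ ⧸ N.subgroupOf N₁ :=
    QuotientGroup.map (L₀.1.subgroupOf U) (N.subgroupOf N₁) (Subgroup.inclusion (le_sup_right : U ≤ N₁)) (by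
      intro x hx
      rw [Subgroup.mem_subgroupOf] at hx
      rw [Subgroup.mem_comap, Subgroup.mem_subgroupOf, Subgroup.coe_inclusion]
      exact Subgroup.mem_sup_right hx)
  have hφ : Function.Surjective φ := by
    intro c
    obtain ⟨n, rfl⟩ := QuotientGroup.mk_surjective c
    obtain ⟨r, hr, u, hu, hru⟩ := Subgroup.mem_sup.1 n.2
    refine ⟨QuotientGroup.mk ⟨u, hu⟩, ?_⟩
    change QuotientGroup.mk (Subgroup.inclusion (le_sup_right : U ≤ N₁) ⟨u, hu⟩) = QuotientGroup.mk n
    rw [QuotientGroup.eq, Subgroup.mem_subgroupOf, Subgroup.coe_mul, Subgroup.coe_inv, Subgroup.coe_inclusion]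
    have : ((⟨u, hu⟩ : ↥U) : ↥(torusFinAdelic L))⁻¹ * (n : ↥(torusFinAdelic L)) = r := by
      rw [← hru]
      change u⁻¹ * (r * u) = r
      rw [mul_comm r u, inv_mul_cancel_left]
    rw [this]
    exact Subgroup.mem_sup_left hr
  haveI : Finite (↥N₁ ⧸ N.subgroupOf N₁) := Finite.of_surjective φ hφ
  haveI hrel : (N.subgroupOf N₁).FiniteIndex := Subgroup.finiteIndex_of_finite_quotient
  haveI : N.FiniteIndex := by
    constructor
    rw [← Subgroup.relIndex_mul_index hNN₁]
    exact mul_ne_zero hrel.1 h₁.1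
  exact Subgroup.finite_quotient_of_finiteIndex

end Main

end Literature.AlgebraicGeometry.ShimuraVarieties.UnitaryCanonicalModel.Aux

end
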